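import Mathlib
import Summits.AnomalousDissipation.AnomalousDissipation.Theses.PointSink
import Summits.AnomalousDissipation.AnomalousDissipation.Theorems.SolitonTransplant.Negative.PointSinkTameNoGo
import Summits.AnomalousDissipation.AnomalousDissipation.Theorems.SolitonTransplant.Negative.PointSinkLocalEnergy
import Summits.AnomalousDissipation.AnomalousDissipation.Theorems.NegSteadyThinSetLiouvilleCutoff
import Summits.AnomalousDissipation.AnomalousDissipation.Theorems.CoherentStatesSteadyNegTameOffThinSets

/-!
# No BOUNDED point sink: a negative lemma for the crux `PointSink.SolitonTransplant`
(stmt-AnomalousDissipation-19035; conclusion = target `PointSinkZerothLaw`, stmt-19032)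

cdisprove record (route `AnomalousDissipation/PointSink`). The crux is
`CascadeSoliton → PointSinkZerothLaw`; its conclusion asks for steady classical states
`(u_j, p_j)` of the `f`-forced Navier–Stokes system on `T³` (`f` smooth, fixed), `ν_j → 0`, with a
dissipation floor `ε ≤ ν_j‖∇u_j‖₂²` and ALL dissipation concentrating at one point `x₀`
(`ν_j ∫_{dist ≥ r} |∇u_j|² → 0` for every `r > 0`).

* `pointSink_dissipationFloor_false_of_bounded` — such a family can NOT be uniformly bounded
  together with its pressures. Proof: the weighted steady energy identity
  (`steady_weighted_energy_identity`, file `PointSinkLocalEnergy.lean`) with the smooth cut-off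
  of `ThinSetLiouville.exists_smooth_cutoff` adapted to `dist(·, x₀)` at scale `r`
  (`χ = 0` on `B_{r/2}(x₀)`, `χ = 1` off `B_{5r/2}(x₀)`, `‖Dχ‖ ≤ r⁻¹`, `Dχ = 0` off `B_{3r}(x₀)`):
  `∫(½‖u_j‖²+p_j)Dχ[u_j] = ν_j∫χ∑‖∂ᵢu_j‖² + ν_j∫∑∂ᵢχ⟪u_j,∂ᵢu_j⟫ − ∫χ⟪f,u_j⟫`. If `‖u_j‖,|p_j| ≤ M`:
  the flux is `≤ (½M²+M)M r⁻¹|B_{3r}(x₀)| ≤ 36(½M³+M²)r` (`volume_thickening_singleton_le`);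
  the weighted dissipation is `≤ ν_j∫_{dist ≥ r/2}∑‖∂ᵢu_j‖² → 0` (concentration); the viscous
  transport term is `≤ √ν_j(‖f‖_∞M/2 + 3M²/(2r²)) → 0` (Young, and `ν_j‖∇u_j‖² = ∫⟪f,u_j⟫ ≤ ‖f‖_∞M`
  by `CoherentStates.steady_energy_identity`); the work is `≥ ε − 36‖f‖_∞M r²`. With
  `r = min(1, ε/(8A))`, `A = 36(½M³+M²) + 36‖f‖_∞M + 1`, this forces
  `ν_j∫_{dist≥r/2}∑‖∂ᵢu_j‖² + √ν_j L ≥ 3ε/4` for all `j` — absurd.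
* `not_pointSinkZerothLaw_bounded` — packaged: the target `X` with the extra clause
  `∃ M, ∀ j x, ‖u_j x‖ ≤ M ∧ |p_j x| ≤ M` is FALSE (refuted natural strengthening).

What a prover must respect: every witness of `X` (hence every successful transplant) has
`‖u_j‖_∞ + ‖p_j‖_∞ → ∞` along a subsequence — quantitatively `sup_{B_{3r}(x₀)}(|u_j|³ + |p_j||u_j|)
≳ ε r⁻²·r³/r² …`, the `dist^{-2/3}` cone of the route — and the bounded-family barrier
`Literature.Barriers.AnomalousDissipation.DeRosaDrivasInversi2024_thm12_bounded/thm19_bounded`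
can never be instantiated on a witness: its evasion by unboundedness is forced, not optional.
Classification: negative lemma / refuted strengthening (no verdict change). [folklore]
-/

set_option linter.dupNamespace false  -- `Summit.AnomalousDissipation.AnomalousDissipation` is the mandated summit/problem namespace

noncomputable section

open MeasureTheory Metric Filter Topology Set
open scoped InnerProductSpace
open Literature.Analysis.FunctionSpaces Literature.Analysis.FunctionSpaces.Torus

namespace Summit.AnomalousDissipation.AnomalousDissipation.Theorems.SolitonTransplant.Negative

/-! ## The bounded-family no-go -/

section NoGo

open Summit.AnomalousDissipation.AnomalousDissipation.Theorems

/-- Young-type absorption used for the viscous transport term: for `s, a ≥ 0`, `c ≥ 0`,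
`s² c a ≤ (s³ a² + s c²)/2` (`= ` half of `s (s a − c)² ≥ 0` rearranged). [folklore] -/
theorem sq_mul_mul_le {s a c : ℝ} (hs : 0 ≤ s) :
    s ^ 2 * c * a ≤ (s ^ 3 * a ^ 2 + s * c ^ 2) / 2 := by
  nlinarith [mul_nonneg hs (sq_nonneg (s * a - c))]

/-- **No bounded point sink.** In the setting of the target `X = PointSinkZerothLaw` — a smooth
force `f` on `T³`, a sink `x₀`, viscosities `ν_j > 0`, `ν_j → 0`, steady classical states
`(u_j, p_j)` of the `f`-forced Navier–Stokes system with the dissipation floor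
`ε ≤ ν_j‖∇u_j‖₂²` and point concentration of the dissipation at `x₀` — the states CANNOT be
uniformly bounded together with their pressures: `sup_j (‖u_j‖_∞ + ‖p_j‖_∞) = ∞`.
Proof: the weighted steady energy identity with a smooth cut-off `χ` vanishing on
`B_{r/2}(x₀)` and equal to `1` off `B_{5r/2}(x₀)` (`ThinSetLiouville.exists_smooth_cutoff`,
`‖Dχ‖ ≤ r⁻¹`, `Dχ = 0` off `B_{3r}(x₀)`) reads `∫(½‖u_j‖²+p_j)Dχ[u_j] = ν_j∫χ∑‖∂ᵢu_j‖² +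
ν_j∫∑∂ᵢχ⟪u_j,∂ᵢu_j⟫ − ∫χ⟪f,u_j⟫`; with `‖u_j‖, |p_j| ≤ M` the flux is `≤ (½M²+M)M r⁻¹|B_{3r}| ≤
36(½M³+M²) r`, the first term on the right is `≤ ν_j∫_{dist ≥ r/2}∑‖∂ᵢu_j‖² → 0`
(concentration), the second is `≤ √ν_j (‖f‖_∞M/2 + 3M²/(2r²)) → 0` (Young + the steady energy
identity `ν_j‖∇u_j‖² = ∫⟪f,u_j⟫ ≤ ‖f‖_∞ M`), and the work is `≥ ε − 36‖f‖_∞ M r²`; for `r`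
small this is absurd. Consequences: (a) every witness of `X` has `‖u_j‖_∞ + ‖p_j‖_∞ → ∞`
along a subsequence (the `-2/3` cone: `|u|³ + |p||u| ≳ ε r⁻²` on `B_{3r}(x₀)`), so (b) the
De Rosa–Drivas–Inversi barrier (`Literature.Barriers.AnomalousDissipation.
DeRosaDrivasInversi2024_thm12_bounded` / `…thm19_bounded`, bounded `u`, `p`) can never be
instantiated on a witness — its evasion by unboundedness is FORCED, not a design choice; (c) the
natural strengthening "`X` with uniformly bounded states" is false. [folklore] -/
theorem pointSink_dissipationFloor_false_of_bounded
    (f : UnitAddTorus (Fin 3) → EuclideanSpace ℝ (Fin 3)) (hf : IsSmooth f)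
    (x₀ : UnitAddTorus (Fin 3))
    (ν : ℕ → ℝ) (u : ℕ → UnitAddTorus (Fin 3) → EuclideanSpace ℝ (Fin 3))
    (p : ℕ → UnitAddTorus (Fin 3) → ℝ) (hν : ∀ j, 0 < ν j) (hν0 : Tendsto ν atTop (𝓝 0))
    (hsol : ∀ j, IsClassicalNSSolutionOn Set.univ (ν j) (fun _ => f) (fun _ => u j)
      (fun _ => p j))
    (hconc : ∀ r : ℝ, 0 < r → Tendsto (fun j => ν j *
      ∫ x in {x : UnitAddTorus (Fin 3) | r ≤ dist x x₀}, ∑ i, ‖partialDeriv i (u j) x‖ ^ 2)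
      atTop (𝓝 0))
    (hbdd : ∃ M : ℝ, ∀ j x, ‖u j x‖ ≤ M ∧ |p j x| ≤ M) :
    ¬ ∃ ε : ℝ, 0 < ε ∧ ∀ j, ε ≤ ν j * gradNormSq (u j) := by
  rintro ⟨ε, hε, hfl⟩
  obtain ⟨M, hM⟩ := hbdd
  have hM0 : 0 ≤ M := le_trans (norm_nonneg _) (hM 0 x₀).1
  -- a bound for the force
  obtain ⟨Cf, hCf'⟩ := (isCompact_range hf.continuous.norm).bddAbove
  have hCf : ∀ x, ‖f x‖ ≤ Cf := fun x => hCf' ⟨x, rfl⟩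
  have hCf0 : 0 ≤ Cf := le_trans (norm_nonneg _) (hCf x₀)
  -- smoothness of the states
  have hu : ∀ j, IsSmooth (u j) := fun j =>
    (hsol j).smooth_velocity.isSmooth_slice (Set.mem_univ (0 : ℝ))
  have hp : ∀ j, IsSmooth (p j) := fun j =>
    (hsol j).smooth_pressure.isSmooth_slice (Set.mem_univ (0 : ℝ))
  -- the steady energy identity bounds `ν_j ‖∇u_j‖² ≤ Cf M`
  have hνG : ∀ j, ν j * gradNormSq (u j) ≤ Cf * M := by
    intro j
    rw [CoherentStates.steady_energy_identity (hsol j)]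
    calc ∫ x, ⟪f x, u j x⟫_ℝ ≤ ∫ x, Cf * M := by
          refine integral_mono (hf.inner (hu j)).integrable (integrable_const _) fun x => ?_
          calc ⟪f x, u j x⟫_ℝ ≤ ‖f x‖ * ‖u j x‖ := real_inner_le_norm _ _
            _ ≤ Cf * M := mul_le_mul (hCf x) (hM j x).1 (norm_nonneg _) hCf0
      _ = Cf * M := by simp
  -- the constants and the radius
  set K : ℝ := (2⁻¹ * M ^ 2 + M) * M with hK_def
  have hK0 : 0 ≤ K := by positivity
  set A : ℝ := 36 * K + 36 * (Cf * M) + 1 with hA_def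
  have hA0 : 0 < A := by positivity
  set r : ℝ := min 1 (ε / (8 * A)) with hr_def
  have hr : 0 < r := lt_min one_pos (by positivity)
  have hr1 : r ≤ 1 := min_le_left _ _
  have hrA : A * r ≤ ε / 8 := by
    have h1 : r ≤ ε / (8 * A) := min_le_right _ _
    calc A * r ≤ A * (ε / (8 * A)) := by gcongr
      _ = ε / 8 := by field_simp
  have hCM0 : 0 ≤ Cf * M := mul_nonneg hCf0 hM0
  have hKr : 36 * K * r ≤ ε / 8 := by
    have h1 : 36 * K * r ≤ A * r := by
      rw [hA_def]; nlinarith [hr.le, hCM0]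
    exact h1.trans hrA
  have hCr : 36 * (Cf * M) * r ^ 2 ≤ ε / 8 := by
    have h0 : r ^ 2 ≤ r := by nlinarith
    have h1 : 36 * (Cf * M) * r ^ 2 ≤ 36 * (Cf * M) * r := by
      exact mul_le_mul_of_nonneg_left h0 (by positivity)
    have h2 : 36 * (Cf * M) * r ≤ A * r := by
      rw [hA_def]; nlinarith [hr.le, hK0]
    exact h1.trans (h2.trans hrA)
  -- the cut-off
  obtain ⟨χ, hχs, hχ01, hχ0, hχ1, hχD, hχD0⟩ :=
    ThinSetLiouville.exists_smooth_cutoff (fun x : UnitAddTorus (Fin 3) => dist x x₀)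
      (LipschitzWith.dist_left x₀) hr
  have hχ1' : IsContDiff 1 χ := hχs.isContDiff (by simp)
  -- volume of small balls around the sink
  have hvol : ∀ ρ : ℝ, 0 < ρ → volume.real (ball x₀ ρ) ≤ 4 * ρ ^ 2 := by
    intro ρ hρ
    rw [measureReal_def]
    refine ENNReal.toReal_le_of_le_ofReal (by positivity) ?_
    rw [← thickening_singleton]
    exact volume_thickening_singleton_le x₀ hρ
  -- notation for the four terms of the identity
  set FL : ℕ → ℝ := fun j => ∫ x, (2⁻¹ * ‖u j x‖ ^ 2 + p j x) * Torus.fderiv χ x (u j x)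
    with hFL_def
  set T1 : ℕ → ℝ := fun j => ∫ x, χ x * ∑ i, ‖partialDeriv i (u j) x‖ ^ 2 with hT1_def
  set T2 : ℕ → ℝ := fun j => ∫ x, ∑ i, partialDeriv i χ x * ⟪u j x, partialDeriv i (u j) x⟫_ℝ
    with hT2_def
  set W : ℕ → ℝ := fun j => ∫ x, χ x * ⟪f x, u j x⟫_ℝ with hW_def
  have hid : ∀ j, FL j = ν j * T1 j + ν j * T2 j - W j := fun j =>
    steady_weighted_energy_identity (hsol j) hχs
  -- (i) the flux is small: `|FL j| ≤ 36 K r`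
  have hFL : ∀ j, |FL j| ≤ 36 * K * r := by
    intro j
    have hbound : ∀ x, ‖(2⁻¹ * ‖u j x‖ ^ 2 + p j x) * Torus.fderiv χ x (u j x)‖ ≤
        K * r⁻¹ * (ball x₀ (3 * r)).indicator (fun _ => (1 : ℝ)) x := by
      intro x
      by_cases hx : 3 * r ≤ dist x x₀
      · rw [hχD0 x hx]
        simp only [mul_zero, norm_zero, zero_apply]
        exact mul_nonneg (mul_nonneg hK0 (inv_nonneg.mpr hr.le))
          (Set.indicator_nonneg (fun _ _ => zero_le_one) _)
      · push Not at hx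
        have hmem : x ∈ ball x₀ (3 * r) := mem_ball.mpr hx
        rw [Set.indicator_of_mem hmem, mul_one, norm_mul, Real.norm_eq_abs, Real.norm_eq_abs]
        have h1 : |2⁻¹ * ‖u j x‖ ^ 2 + p j x| ≤ 2⁻¹ * M ^ 2 + M := by
          calc |2⁻¹ * ‖u j x‖ ^ 2 + p j x| ≤ |2⁻¹ * ‖u j x‖ ^ 2| + |p j x| := abs_add_le _ _
            _ ≤ 2⁻¹ * M ^ 2 + M := by
                rw [abs_of_nonneg (by positivity)]
                gcongr
                · exact (hM j x).1
                · exact (hM j x).2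
        have h2 : |Torus.fderiv χ x (u j x)| ≤ r⁻¹ * M := by
          calc |Torus.fderiv χ x (u j x)| = ‖Torus.fderiv χ x (u j x)‖ := (Real.norm_eq_abs _).symm
            _ ≤ ‖Torus.fderiv χ x‖ * ‖u j x‖ := ContinuousLinearMap.le_opNorm _ _
            _ ≤ r⁻¹ * M := mul_le_mul (hχD x) (hM j x).1 (norm_nonneg _) (inv_nonneg.mpr hr.le)
        calc |2⁻¹ * ‖u j x‖ ^ 2 + p j x| * |Torus.fderiv χ x (u j x)|
            ≤ (2⁻¹ * M ^ 2 + M) * (r⁻¹ * M) :=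
              mul_le_mul h1 h2 (abs_nonneg _) (by positivity)
          _ = K * r⁻¹ := by rw [hK_def]; ring
    have hint : Integrable (fun x => K * r⁻¹ * (ball x₀ (3 * r)).indicator (fun _ => (1 : ℝ)) x)
        volume := ((integrable_const (1 : ℝ)).indicator measurableSet_ball).const_mul _
    have h := norm_integral_le_of_norm_le hint (ae_of_all _ hbound)
    rw [integral_const_mul, integral_indicator measurableSet_ball, setIntegral_const, smul_eq_mul,
      mul_one, Real.norm_eq_abs] at h
    calc |FL j| ≤ K * r⁻¹ * volume.real (ball x₀ (3 * r)) := h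
      _ ≤ K * r⁻¹ * (4 * (3 * r) ^ 2) := by gcongr; exact hvol _ (by positivity)
      _ = 36 * K * r := by field_simp; ring
  -- (ii) the weighted dissipation is eventually small
  have hT1 : ∀ j, 0 ≤ ν j * T1 j ∧ ν j * T1 j ≤ ν j *
      ∫ x in {x : UnitAddTorus (Fin 3) | r / 2 ≤ dist x x₀}, ∑ i, ‖partialDeriv i (u j) x‖ ^ 2 := by
    intro j
    have hF : IsSmooth (fun x => ∑ i, ‖partialDeriv i (u j) x‖ ^ 2) := by
      have h := ContDiff.sum (s := (Finset.univ : Finset (Fin 3)))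
        (fun i (_ : i ∈ Finset.univ) => ((hu j).partialDeriv i).norm_sq)
      exact h
    have hF0 : ∀ x, 0 ≤ ∑ i, ‖partialDeriv i (u j) x‖ ^ 2 := fun x =>
      Finset.sum_nonneg fun i _ => sq_nonneg _
    have hAm : MeasurableSet {x : UnitAddTorus (Fin 3) | r / 2 ≤ dist x x₀} :=
      (isClosed_le continuous_const (continuous_id.dist continuous_const)).measurableSet
    constructor
    · exact mul_nonneg (hν j).le (integral_nonneg fun x => mul_nonneg (hχ01 x).1 (hF0 x))
    · refine mul_le_mul_of_nonneg_left ?_ (hν j).le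
      rw [← integral_indicator hAm]
      refine integral_mono (isSmooth_mul hχs hF).integrable (hF.integrable.indicator hAm) fun x => ?_
      by_cases hx : x ∈ {x : UnitAddTorus (Fin 3) | r / 2 ≤ dist x x₀}
      · rw [Set.indicator_of_mem hx]
        calc χ x * ∑ i, ‖partialDeriv i (u j) x‖ ^ 2 ≤ 1 * ∑ i, ‖partialDeriv i (u j) x‖ ^ 2 :=
              mul_le_mul_of_nonneg_right (hχ01 x).2 (hF0 x)
          _ = _ := one_mul _
      · rw [Set.indicator_of_notMem hx]
        have hlt : dist x x₀ < r / 2 := by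
          simp only [mem_setOf_eq, not_le] at hx; exact hx
        rw [hχ0 x hlt, zero_mul]
  -- (iii) the viscous transport term is `≤ √ν_j (Cf M / 2 + 3 M² / (2 r²))`
  set L : ℝ := Cf * M / 2 + 3 * M ^ 2 / (2 * r ^ 2) with hL_def
  have hT2 : ∀ j, |ν j * T2 j| ≤ Real.sqrt (ν j) * L := by
    intro j
    set s : ℝ := Real.sqrt (ν j) with hs_def
    have hs0 : 0 ≤ s := Real.sqrt_nonneg _
    have hs2 : s ^ 2 = ν j := Real.sq_sqrt (hν j).le
    have hdχ : ∀ i x, |partialDeriv i χ x| ≤ r⁻¹ := by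
      intro i x
      rw [partialDeriv_eq_fderiv_apply hχ1']
      calc |Torus.fderiv χ x (EuclideanSpace.single i 1)|
          = ‖Torus.fderiv χ x (EuclideanSpace.single i 1)‖ := (Real.norm_eq_abs _).symm
        _ ≤ ‖Torus.fderiv χ x‖ * ‖EuclideanSpace.single i (1 : ℝ)‖ := ContinuousLinearMap.le_opNorm _ _
        _ ≤ r⁻¹ * 1 := by
            gcongr
            · exact hχD x
            · rw [PiLp.norm_single, norm_one]
        _ = r⁻¹ := mul_one _
    -- pointwise Young bound
    have hpt : ∀ x, ‖ν j * ∑ i, partialDeriv i χ x * ⟪u j x, partialDeriv i (u j) x⟫_ℝ‖ ≤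
        ∑ i, (s ^ 3 * ‖partialDeriv i (u j) x‖ ^ 2 + s * (M / r) ^ 2) / 2 := by
      intro x
      rw [Real.norm_eq_abs, abs_mul, abs_of_pos (hν j)]
      calc ν j * |∑ i, partialDeriv i χ x * ⟪u j x, partialDeriv i (u j) x⟫_ℝ|
          ≤ ν j * ∑ i, |partialDeriv i χ x * ⟪u j x, partialDeriv i (u j) x⟫_ℝ| := by
            gcongr
            · exact (hν j).le
            · exact Finset.abs_sum_le_sum_abs _ _
        _ = ∑ i, ν j * |partialDeriv i χ x * ⟪u j x, partialDeriv i (u j) x⟫_ℝ| :=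
            Finset.mul_sum _ _ _
        _ ≤ _ := Finset.sum_le_sum fun i _ => ?_
      rw [abs_mul]
      have ha : 0 ≤ ‖partialDeriv i (u j) x‖ := norm_nonneg _
      have h1 : |⟪u j x, partialDeriv i (u j) x⟫_ℝ| ≤ M * ‖partialDeriv i (u j) x‖ :=
        (abs_real_inner_le_norm _ _).trans (mul_le_mul_of_nonneg_right (hM j x).1 ha)
      calc ν j * (|partialDeriv i χ x| * |⟪u j x, partialDeriv i (u j) x⟫_ℝ|)
          ≤ ν j * (r⁻¹ * (M * ‖partialDeriv i (u j) x‖)) := by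
            gcongr
            · exact (hν j).le
            · exact hdχ i x
        _ = s ^ 2 * (M / r) * ‖partialDeriv i (u j) x‖ := by rw [hs2]; ring
        _ ≤ (s ^ 3 * ‖partialDeriv i (u j) x‖ ^ 2 + s * (M / r) ^ 2) / 2 := sq_mul_mul_le hs0
    have hGi : ∀ i, Integrable (fun x => ‖partialDeriv i (u j) x‖ ^ 2) volume := fun i =>
      ((hu j).partialDeriv i).norm_sq.integrable
    have hIi : ∀ i, Integrable (fun x => (s ^ 3 * ‖partialDeriv i (u j) x‖ ^ 2 + s * (M / r) ^ 2) / 2)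
        volume := fun i => (((hGi i).const_mul _).add (integrable_const _)).div_const _
    have hint : Integrable (fun x => ∑ i, (s ^ 3 * ‖partialDeriv i (u j) x‖ ^ 2 + s * (M / r) ^ 2) / 2)
        volume := integrable_finsetSum _ fun i _ => hIi i
    have h := norm_integral_le_of_norm_le hint (ae_of_all _ hpt)
    rw [integral_const_mul, Real.norm_eq_abs] at h
    refine h.trans ?_
    -- evaluate the right-hand side
    rw [integral_finsetSum _ fun i _ => hIi i]
    have hterm : ∀ i, ∫ x, (s ^ 3 * ‖partialDeriv i (u j) x‖ ^ 2 + s * (M / r) ^ 2) / 2 =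
        (s ^ 3 * ∫ x, ‖partialDeriv i (u j) x‖ ^ 2) / 2 + s * (M / r) ^ 2 / 2 := by
      intro i
      rw [integral_div, integral_add ((hGi i).const_mul _) (integrable_const _), integral_const_mul,
        integral_const]
      simp
      ring
    simp_rw [hterm]
    rw [Finset.sum_add_distrib, Finset.sum_const, Finset.card_univ, Fintype.card_fin,
      ← Finset.sum_div, ← Finset.mul_sum]
    have hG : ∑ i, ∫ x, ‖partialDeriv i (u j) x‖ ^ 2 = gradNormSq (u j) := by
      rw [gradNormSq, integral_finsetSum _ fun i _ => hGi i]
    rw [hG]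
    have hs3 : s ^ 3 * gradNormSq (u j) = s * (ν j * gradNormSq (u j)) := by rw [← hs2]; ring
    have hGn : 0 ≤ ν j * gradNormSq (u j) := mul_nonneg (hν j).le (gradNormSq_nonneg _)
    calc s ^ 3 * gradNormSq (u j) / 2 + (3 : ℕ) • (s * (M / r) ^ 2 / 2)
        = s * (ν j * gradNormSq (u j)) / 2 + 3 * (s * (M / r) ^ 2 / 2) := by
          rw [hs3, nsmul_eq_mul]; norm_num
      _ ≤ s * (Cf * M) / 2 + 3 * (s * (M / r) ^ 2 / 2) := by
          have := mul_le_mul_of_nonneg_left (hνG j) hs0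
          linarith
      _ = s * L := by rw [hL_def]; ring
  -- (iv) the work is almost all of `ε`
  have hW : ∀ j, ε - 36 * (Cf * M) * r ^ 2 ≤ W j := by
    intro j
    have hI1 : Integrable (fun x => ⟪f x, u j x⟫_ℝ) volume := (hf.inner (hu j)).integrable
    have hI2 : Integrable (fun x => (1 - χ x) * ⟪f x, u j x⟫_ℝ) volume :=
      (isSmooth_mul ((isSmooth_const (1 : ℝ)).sub hχs) (hf.inner (hu j))).integrable
    have hWsplit : W j = (∫ x, ⟪f x, u j x⟫_ℝ) - ∫ x, (1 - χ x) * ⟪f x, u j x⟫_ℝ := by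
      rw [← integral_sub hI1 hI2]
      refine integral_congr_ae (ae_of_all _ fun x => ?_)
      simp only
      ring
    have hE1 : ε ≤ ∫ x, ⟪f x, u j x⟫_ℝ :=
      (hfl j).trans_eq (CoherentStates.steady_energy_identity (hsol j))
    have hbound : ∀ x, ‖(1 - χ x) * ⟪f x, u j x⟫_ℝ‖ ≤
        Cf * M * (ball x₀ (3 * r)).indicator (fun _ => (1 : ℝ)) x := by
      intro x
      by_cases hx : 5 * r / 2 < dist x x₀
      · rw [hχ1 x hx]
        simp only [sub_self, zero_mul, norm_zero]
        exact mul_nonneg (mul_nonneg hCf0 hM0) (Set.indicator_nonneg (fun _ _ => zero_le_one) _)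
      · push Not at hx
        have hmem : x ∈ ball x₀ (3 * r) := mem_ball.mpr (by linarith)
        rw [Set.indicator_of_mem hmem, mul_one, norm_mul, Real.norm_eq_abs, Real.norm_eq_abs]
        have h1 : |1 - χ x| ≤ 1 := by
          rw [abs_le]; constructor <;> linarith [(hχ01 x).1, (hχ01 x).2]
        have h2 : |⟪f x, u j x⟫_ℝ| ≤ Cf * M :=
          (abs_real_inner_le_norm _ _).trans (mul_le_mul (hCf x) (hM j x).1 (norm_nonneg _) hCf0)
        calc |1 - χ x| * |⟪f x, u j x⟫_ℝ| ≤ 1 * (Cf * M) :=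
              mul_le_mul h1 h2 (abs_nonneg _) zero_le_one
          _ = Cf * M := one_mul _
    have hint : Integrable (fun x => Cf * M * (ball x₀ (3 * r)).indicator (fun _ => (1 : ℝ)) x)
        volume := ((integrable_const (1 : ℝ)).indicator measurableSet_ball).const_mul _
    have h := norm_integral_le_of_norm_le hint (ae_of_all _ hbound)
    rw [integral_const_mul, integral_indicator measurableSet_ball, setIntegral_const, smul_eq_mul,
      mul_one, Real.norm_eq_abs] at h
    have hE2 : |∫ x, (1 - χ x) * ⟪f x, u j x⟫_ℝ| ≤ 36 * (Cf * M) * r ^ 2 := by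
      calc |∫ x, (1 - χ x) * ⟪f x, u j x⟫_ℝ| ≤ Cf * M * volume.real (ball x₀ (3 * r)) := h
        _ ≤ Cf * M * (4 * (3 * r) ^ 2) := by gcongr; exact hvol _ (by positivity)
        _ = 36 * (Cf * M) * r ^ 2 := by ring
    rw [hWsplit]
    linarith [(abs_le.mp hE2).2]
  -- the two vanishing quantities
  set o : ℕ → ℝ := fun j => ν j *
      (∫ x in {x : UnitAddTorus (Fin 3) | r / 2 ≤ dist x x₀}, ∑ i, ‖partialDeriv i (u j) x‖ ^ 2) +
      Real.sqrt (ν j) * L with ho_def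
  have hlim : Tendsto o atTop (𝓝 0) := by
    have h1 := hconc (r / 2) (by positivity)
    have h2 : Tendsto (fun j => Real.sqrt (ν j) * L) atTop (𝓝 0) := by
      have h := (Real.continuous_sqrt.tendsto 0).comp hν0
      rw [Real.sqrt_zero] at h
      simpa using h.mul_const L
    simpa [ho_def] using h1.add h2
  have hbig : ∀ j, 3 * ε / 4 ≤ o j := by
    intro j
    have h1 := hid j
    have h2 := abs_le.mp (hFL j)
    have h3 := hT1 j
    have h4 := abs_le.mp (hT2 j)
    have h5 := hW j
    simp only [ho_def]
    linarith [h2.1, h2.2, h3.1, h3.2, h4.1, h4.2]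
  have hev : ∀ᶠ j in atTop, o j < 3 * ε / 4 := hlim (Iio_mem_nhds (by linarith))
  obtain ⟨j, hj⟩ := hev.exists
  exact absurd (hbig j) (not_le.mpr hj)

/-- **The bounded strengthening of the target is false.** `PointSinkZerothLaw` (the conclusion of
the crux `SolitonTransplant`) with the extra clause "the states and pressures are uniformly
bounded" has NO witness: verbatim the clauses of `PointSinkZerothLaw` plus
`∃ M, ∀ j x, ‖u_j x‖ ≤ M ∧ |p_j x| ≤ M`. (Refuted natural strengthening; the energy bound, the
divergence-free and mean-zero clauses of the force are not even used.) [folklore] -/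
theorem not_pointSinkZerothLaw_bounded :
    ¬ (∃ f : UnitAddTorus (Fin 3) → EuclideanSpace ℝ (Fin 3), IsSmooth f ∧ IsDivFree f ∧ HasZeroMean f ∧
      ∃ (x₀ : UnitAddTorus (Fin 3)) (ν : ℕ → ℝ) (u : ℕ → UnitAddTorus (Fin 3) → EuclideanSpace ℝ (Fin 3))
        (p : ℕ → UnitAddTorus (Fin 3) → ℝ), (∀ j, 0 < ν j) ∧ Filter.Tendsto ν Filter.atTop (nhds 0) ∧
        (∀ j, IsClassicalNSSolutionOn Set.univ (ν j) (fun _ => f) (fun _ => u j) (fun _ => p j)) ∧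
        (∃ E : ℝ, ∀ j, MeasureTheory.integral MeasureTheory.volume (fun x => ‖u j x‖ ^ 2) ≤ E) ∧
        (∃ ε : ℝ, 0 < ε ∧ ∀ j, ε ≤ ν j * gradNormSq (u j)) ∧
        (∀ r : ℝ, 0 < r → Filter.Tendsto (fun j => ν j * ∫ x in {x : UnitAddTorus (Fin 3) | r ≤ dist x x₀},
          ∑ i, ‖partialDeriv i (u j) x‖ ^ 2) Filter.atTop (nhds 0)) ∧
        ∃ M : ℝ, ∀ j x, ‖u j x‖ ≤ M ∧ |p j x| ≤ M) := by
  rintro ⟨f, hf, -, -, x₀, ν, u, p, hν, hν0, hsol, -, hfloor, hconc, hbdd⟩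
  exact pointSink_dissipationFloor_false_of_bounded f hf x₀ ν u p hν hν0 hsol hconc hbdd hfloor

end NoGo

end Summit.AnomalousDissipation.AnomalousDissipation.Theorems.SolitonTransplant.Negative

end
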